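import Summits.BirchSwinnertonDyer.BirchSwinnertonDyer.Theorems.GenusKolyvaginAtTwoCasselsTatePTcTotallyComplex
import Summits.BirchSwinnertonDyer.BirchSwinnertonDyer.Theorems.GenusKolyvaginAtTwoCasselsTateLemma615AnyLevel
import Literature.NumberTheory.EllipticCurves.BSDShaCasselsTateLevelwise
import Literature.NumberTheory.EllipticCurves.WeilPairingProofs
import HarnessLib

/-!
# Over a TOTALLY COMPLEX number field the Cassels–Tate pairing of THE canonical invariant maps is a LEVEL pairing at every
# prime-power level as soon as it is alternating — unconditionally at the odd levels, modulo Cassels' alternation at `2^k`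

Route `GenusKolyvaginAtTwo`, crux `KolyvaginExactAtTwo` (stmt-BirchSwinnertonDyer-22137) → Q3-inner, Cassels–Tate block at the
EVEN level; seat `bsd-line-gk2-p2` g13 (cell `bsd-f1-sign2`), `--supports 22137`, helper. THEOREMS ONLY (no definition, no named
fact, no `sorry`, no instance).

Assembly of the tree's `isLevelPairing_ctLevelPairing_of_inputs` (`CasselsTateFiniteSupport.lean`: inputs `hPT'`, `hH3`, `hPTc`,
`h615`, `hct_alt`) for `inv := LocalInvariants.canonical K (m·m)`, `m = p^k`, `K` totally complex (e.g. the Heegner field of the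
route), EVERY elliptic curve `E/K`:
`hPT'` = Tate's reciprocity `sumInvLocalizationEqZero_canonical_of_numberField`; `hH3` = `H³(K, μ) = 0` (no real places,
`CasselsTatePTc.galoisCohomology_three_mu_eq_zero_of_isTotallyComplex'`); `hPTc` = `CasselsTatePTc.hPTc_canonical_of_isTotallyComplex`
(this seat, the Ш²-cochain bridge at every level over a totally complex field); `h615` = `CasselsTateAnyLevel.lemma615Input_canonical`
(this seat, every level, every number field). Hence:

* `isLevelPairing_ctLevelPairing_canonical_of_isTotallyComplex` — level pairing at `m = p^k` from `hct_alt` ALONE (any prime `p`);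
* `isLevelPairing_ctLevelPairing_canonical_of_isTotallyComplex_of_odd` — UNCONDITIONAL at odd `p` (alternation is the tree's
  `ctGeneralFun_self_eq_zero_of_odd`), for EVERY `E/K` (cell bsd-wall's `casselsTate_levelInputs K` covers base changes from `ℚ`);
* `exists_isLevelPairing_of_isTotallyComplex_of_alt` — existence form at `2^k` (the hypothesis shape of
  `WeierstrassCurve.exists_casselsTate_pairing_of_levelwise`), modulo `hct_alt` — LEAD gk2-p1's lane (`…CasselsTateSelfPairingLevel`);
* **`exists_casselsTate_pairing_of_isTotallyComplex_of_alt`** — the tree's Cassels–Tate fact `exists_casselsTate_pairing (K := K)`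
  (pairing on all of `Ш(E/K)` with divisible kernel, every `E/K`) for `K` totally complex, MODULO alternation at the `2`-power levels
  ONLY (levelwise assembly + `exists_weilPairing_holds`).

BSD is not proved by any of this.

References: [MilneADT2006] I Thm. 4.10, §6 Prop. 6.9, Rem. 6.10–6.11, Thm. 6.13 (a), Lemma 6.15; [Cassels1962ArithmeticIV];
[SilvermanAEC2009] Thm. X.4.14.
-/

noncomputable section

open scoped Classical

-- the Theorems namespace of this sub repeats the summit name by design (D-0017 nested layout)
set_option linter.dupNamespace false
set_option autoImplicit false

namespace Summit.BirchSwinnertonDyer.BirchSwinnertonDyer.Theorems.GenusExact.CasselsTatePTc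

open CategoryTheory _root_.WeierstrassCurve Field Function NumberField IsDedekindDomain
open Literature.NumberTheory.EllipticCurves
open Literature.NumberTheory.GaloisRepresentations Literature.NumberTheory.GaloisCohomology
open Literature.NumberTheory.GaloisRepresentations.DiscreteGaloisModule (mu MuCarrier)

/-! ## §5 The Cassels–Tate pairing of THE maps over a totally complex field is a LEVEL pairing as soon as it is alternating -/

section LevelPairing

variable {K : Type} [Field K] [NumberField K] (W : WeierstrassCurve K) [W.IsElliptic] (p k : ℕ) [Fact p.Prime]
variable (e : geomTorsion W ((p ^ k * p ^ k : ℕ) : ℤ) → geomTorsion W ((p ^ k * p ^ k : ℕ) : ℤ) → AlgebraicClosure K)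
  (hμ : ∀ S T, e S T ^ (p ^ k * p ^ k) = 1)
  (hadd₁ : ∀ S₁ S₂ T, e (S₁ + S₂) T = e S₁ T * e S₂ T)
  (hadd₂ : ∀ S T₁ T₂, e S (T₁ + T₂) = e S T₁ * e S T₂)
  (hgal : ∀ (σ : absoluteGaloisGroup K) (S T : geomTorsion W ((p ^ k * p ^ k : ℕ) : ℤ)), σ • e S T = e (σ • S) (σ • T))
  (halt : ∀ T, e T T = 1) (hnd : ∀ T, (∀ S, e S T = 1) → T = 0)

/-- `Ш³(K, μ_n) = 0` over a totally complex field, in the displayed shape of the Cassels–Tate recipe. [cite: MilneADT2006, Ch. I, Thm. 4.10 (c)] -/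
theorem shaThree_mu_eq_zero_of_isTotallyComplex [IsTotallyComplex K] (n : ℕ) [NeZero n] :
    ∀ c : galoisCohomology (mu K n) 3, (∀ v : Place K, galoisCohomology.localization (mu K n) v 3 c = 0) → c = 0 :=
  fun c _ => galoisCohomology_three_mu_eq_zero_of_isTotallyComplex' K n c

include hnd in
/-- **Over a TOTALLY COMPLEX number field, at EVERY prime-power level `m = p^k` (`k ≥ 1`, any prime `p` — so `p = 2`), the
Cassels–Tate pairing `ctLevelPairing` of THE canonical invariant maps on `Ш(E/K)[m]` is a LEVEL pairing (alternating, kernel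
`Ш[m] ∩ mШ`) AS SOON AS its general-case value is alternating on `Ш[m]` (`hct_alt`)** — for every elliptic curve `E/K` and every
Weil-type pairing `e` on `E[m²]`: the tree's `isLevelPairing_ctLevelPairing_of_inputs` with `hPT'` = Tate's reciprocity
(`sumInvLocalizationEqZero_canonical_of_numberField`), `hH3` = §1, `hPTc` = `hPTc_canonical_of_isTotallyComplex` (§4) and
`h615` = `CasselsTateAnyLevel.lemma615Input_canonical` (S₀ = ∅). At the Heegner field of the route this is `hB` of the K-frame
capstones modulo LEAD gk2-p1's `hct_alt` at `2`-power level. [cite: MilneADT2006, Ch. I §6 Prop. 6.9, Thm. 6.13 (a), Lemma 6.15, Thm. 4.10]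
[cite: Cassels1962ArithmeticIV] -/
theorem isLevelPairing_ctLevelPairing_canonical_of_isTotallyComplex [IsTotallyComplex K] [NeZero (p ^ k)]
    [NeZero (p ^ k * p ^ k)] (hk : 0 < k)
    (hct_alt : ∀ a ∈ W.sha, ((p ^ k : ℕ) : ℤ) • a = 0 →
      ctGeneralFun W (p ^ k) e hμ hadd₁ hadd₂ hgal (LocalInvariants.canonical K (p ^ k * p ^ k)) a a = 0) :
    Literature.GroupTheory.FiniteAbelian.IsLevelPairing (p ^ k)
      (ctLevelPairing W (p ^ k) e hμ hadd₁ hadd₂ hgal (LocalInvariants.canonical K (p ^ k * p ^ k)) halt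
        (sumInvLocalizationEqZero_canonical_of_numberField K (p ^ k * p ^ k))
        (shaThree_mu_eq_zero_of_isTotallyComplex (K := K) (p ^ k * p ^ k))
        (localTerm_finite_support W (p ^ k) e hμ hadd₁ hadd₂ hgal halt (LocalInvariants.canonical K (p ^ k * p ^ k)))) := by
  haveI : Finite (geomTorsion W ((p ^ k : ℕ) : ℤ)) := finite_geomTorsion_of_neZero W (p ^ k)
  exact isLevelPairing_ctLevelPairing_of_inputs W (p ^ k) e hμ hadd₁ hadd₂ hgal
    (LocalInvariants.canonical K (p ^ k * p ^ k)) halt (sumInvLocalizationEqZero_canonical_of_numberField K (p ^ k * p ^ k))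
    (shaThree_mu_eq_zero_of_isTotallyComplex (K := K) (p ^ k * p ^ k))
    (fun f hf => hPTc_canonical_of_isTotallyComplex W (p ^ k) e hμ hadd₁ hadd₂ hgal halt hnd f hf) ∅
    (fun S _ x hx => CasselsTateAnyLevel.lemma615Input_canonical W p k e hμ hadd₁ hadd₂ hgal halt hnd hk S x hx) hct_alt

include hnd in
/-- **At an ODD prime-power level over a totally complex field the Cassels–Tate pairing of THE maps is a level pairing,
UNCONDITIONALLY, for EVERY elliptic curve `E/K`** (alternation at odd `m` is the tree's `ctGeneralFun_self_eq_zero_of_odd`;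
cell bsd-wall's `casselsTate_levelInputs K` gave this for base changes `E = W_ℚ ⊗ K` only, the shape of its named fact).
[cite: MilneADT2006, Ch. I §6 Prop. 6.9, Thm. 6.13 (a), Rem. 6.10–6.11][cite: Cassels1962ArithmeticIV] -/
theorem isLevelPairing_ctLevelPairing_canonical_of_isTotallyComplex_of_odd [IsTotallyComplex K] [NeZero (p ^ k)]
    [NeZero (p ^ k * p ^ k)] (hk : 0 < k) (hp2 : p ≠ 2) :
    Literature.GroupTheory.FiniteAbelian.IsLevelPairing (p ^ k)
      (ctLevelPairing W (p ^ k) e hμ hadd₁ hadd₂ hgal (LocalInvariants.canonical K (p ^ k * p ^ k)) halt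
        (sumInvLocalizationEqZero_canonical_of_numberField K (p ^ k * p ^ k))
        (shaThree_mu_eq_zero_of_isTotallyComplex (K := K) (p ^ k * p ^ k))
        (localTerm_finite_support W (p ^ k) e hμ hadd₁ hadd₂ hgal halt (LocalInvariants.canonical K (p ^ k * p ^ k)))) :=
  have hodd : Odd (p ^ k) := ((Fact.out : p.Prime).odd_of_ne_two hp2).pow
  isLevelPairing_ctLevelPairing_canonical_of_isTotallyComplex W p k e hμ hadd₁ hadd₂ hgal halt hnd hk
    fun _ ha hma => ctGeneralFun_self_eq_zero_of_odd (LocalInvariants.canonical K (p ^ k * p ^ k)) halt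
      (sumInvLocalizationEqZero_canonical_of_numberField K (p ^ k * p ^ k))
      (shaThree_mu_eq_zero_of_isTotallyComplex (K := K) (p ^ k * p ^ k))
      (localTerm_finite_support W (p ^ k) e hμ hadd₁ hadd₂ hgal halt _) hodd ha hma

include halt hnd in
/-- **Existence form at the `2`-power levels over a totally complex field**: a level pairing on `Ш(E/K)[2^k]` exists as soon as the
general-case Cassels–Tate value of THE maps is alternating there — the hypothesis shape of the tree's
`WeierstrassCurve.exists_casselsTate_pairing_of_levelwise` at `p = 2`. [cite: MilneADT2006, Ch. I §6, Thm. 6.13 (a)]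
[cite: SilvermanAEC2009, Thm. X.4.14] -/
theorem exists_isLevelPairing_of_isTotallyComplex_of_alt [IsTotallyComplex K] [NeZero (p ^ k)] [NeZero (p ^ k * p ^ k)]
    (hk : 0 < k)
    (hct_alt : ∀ a ∈ W.sha, ((p ^ k : ℕ) : ℤ) • a = 0 →
      ctGeneralFun W (p ^ k) e hμ hadd₁ hadd₂ hgal (LocalInvariants.canonical K (p ^ k * p ^ k)) a a = 0) :
    ∃ B : AddSubgroup.torsionBy W.sha (p ^ k) →+ AddSubgroup.torsionBy W.sha (p ^ k) →+ AddCircle (1 : ℚ),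
      Literature.GroupTheory.FiniteAbelian.IsLevelPairing (p ^ k) B :=
  ⟨_, isLevelPairing_ctLevelPairing_canonical_of_isTotallyComplex W p k e hμ hadd₁ hadd₂ hgal halt hnd hk hct_alt⟩

end LevelPairing

/-! ## The Cassels–Tate fact over a totally complex field, modulo alternation at the `2`-power levels -/

section Fact

variable {K : Type} [Field K] [NumberField K]

/-- **`WeierstrassCurve.exists_casselsTate_pairing (K := K)` — the Cassels–Tate pairing on `Ш(E/K)` with divisible kernel for every
elliptic curve over a TOTALLY COMPLEX number field `K` (Milne I Thm. 6.13 / Silverman X.4.14) — MODULO ONE displayed input: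
Cassels' alternation `⟨a, a⟩ = 0` of the general-case pairing of THE maps at the `2`-POWER levels** (`halt2`; LEAD gk2-p1's lane,
`…CasselsTateSelfPairingLevel`). Levelwise assembly `exists_casselsTate_pairing_of_levelwise`: the Weil pairing on `E[p^{2k}]` is the
tree's `exists_weilPairing_holds`; odd `p` — `isLevelPairing_ctLevelPairing_canonical_of_isTotallyComplex_of_odd` (unconditional);
`p = 2` — `exists_isLevelPairing_of_isTotallyComplex_of_alt`. E.g. `K` the Heegner field of the route: gk2-p3's SquareAllowance
(`isSquare_natCard_primaryComponent_sha_of_casselsTate`, one free bit of U) is thereby conditional on `halt2` only.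
[cite: MilneADT2006, Ch. I §6 Prop. 6.9, Thm. 6.13 (a)(b)][cite: SilvermanAEC2009, Thm. X.4.14][cite: Cassels1962ArithmeticIV] -/
theorem exists_casselsTate_pairing_of_isTotallyComplex_of_alt [IsTotallyComplex K]
    (halt2 : ∀ (W : WeierstrassCurve K) [W.IsElliptic] (k : ℕ), 0 < k →
      ∀ [NeZero (2 ^ k)] [NeZero (2 ^ k * 2 ^ k)]
        (e : geomTorsion W ((2 ^ k * 2 ^ k : ℕ) : ℤ) → geomTorsion W ((2 ^ k * 2 ^ k : ℕ) : ℤ) → AlgebraicClosure K)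
        (hμ : ∀ S T, e S T ^ (2 ^ k * 2 ^ k) = 1)
        (hadd₁ : ∀ S₁ S₂ T, e (S₁ + S₂) T = e S₁ T * e S₂ T)
        (hadd₂ : ∀ S T₁ T₂, e S (T₁ + T₂) = e S T₁ * e S T₂)
        (hgal : ∀ (σ : absoluteGaloisGroup K) (S T : geomTorsion W ((2 ^ k * 2 ^ k : ℕ) : ℤ)),
          σ • e S T = e (σ • S) (σ • T)),
        (∀ T, e T T = 1) → (∀ T, (∀ S, e S T = 1) → T = 0) →
        ∀ a ∈ W.sha, ((2 ^ k : ℕ) : ℤ) • a = 0 →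
          ctGeneralFun W (2 ^ k) e hμ hadd₁ hadd₂ hgal (LocalInvariants.canonical K (2 ^ k * 2 ^ k)) a a = 0) :
    WeierstrassCurve.exists_casselsTate_pairing (K := K) := by
  refine WeierstrassCurve.exists_casselsTate_pairing_of_levelwise (K := K) fun W _ p k hp hk => ?_
  haveI : Fact p.Prime := ⟨hp⟩
  haveI : NeZero (p ^ k) := ⟨pow_ne_zero _ hp.ne_zero⟩
  haveI : NeZero (p ^ k * p ^ k) := ⟨mul_ne_zero (NeZero.ne _) (NeZero.ne _)⟩
  -- the Weil pairing on `E[p^k · p^k]`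
  have hpk : 2 ≤ p ^ k := le_trans hp.two_le (Nat.le_self_pow hk.ne' p)
  have h2 : 2 ≤ p ^ k * p ^ k := le_trans hpk (Nat.le_mul_of_pos_right _ (NeZero.pos _))
  have hne : ((p ^ k * p ^ k : ℕ) : K) ≠ 0 := Nat.cast_ne_zero.2 (NeZero.ne _)
  obtain ⟨e, hμ, hadd₁, hadd₂, halt, hnd, hgal⟩ := exists_weilPairing_holds W (p ^ k * p ^ k) h2 hne
  by_cases hp2 : p = 2
  · subst hp2
    exact exists_isLevelPairing_of_isTotallyComplex_of_alt W 2 k e hμ hadd₁ hadd₂ hgal halt hnd hk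
      (halt2 W k hk e hμ hadd₁ hadd₂ hgal halt hnd)
  · exact ⟨_, isLevelPairing_ctLevelPairing_canonical_of_isTotallyComplex_of_odd W p k e hμ hadd₁ hadd₂ hgal halt hnd hk hp2⟩

end Fact

end Summit.BirchSwinnertonDyer.BirchSwinnertonDyer.Theorems.GenusExact.CasselsTatePTc

end
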